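import Summits.ABC.IUTFork.Cor312LicenceTripleHullCellRefute
import Summits.ABC.IUTFork.Cor312GenuineKLocalTypeFifteenRatPoint
import Summits.ABC.IUTFork.Cor312GenuineKWildLowerBound
import Summits.ABC.IUTFork.Conditional.AbcOfSGenuineKTameRobustParity
import Summits.ABC.IUTFork.Repair.RHReachLedgerQ2GenuineRationalJ
import HarnessLib

/-!
# The hull licence at the `K`-level datum of an abc triple REFUTED from failing hull cells at a TAME pole, ROBUSTLY OVER THE KERNEL CLASS
# of local types («W:REF-BANDS-EXACT» engine; class version of abc-iut-w5-d009's pinned socket `WRow.not_licence_triple_of_not_hullCell`)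

PROOF-ONLY file (D-0012; 0 definitions, 0 `Prop` facts, no instance) of the abc-iut cell — D-0079 RESCUE sub-cell R-W «WINDOW Θ-SIDE
INEQUALITY», seat abc-iut-W-neg-1 (gen 4), row «W:REF-BANDS-EXACT» (abc-iut-plan C-R83 (c); engine deconfliction with abc-iut-W-num-6 gen 4:
ONE generic theorem, consumed BY NAME by every datum band at a tame pole). TAKES NO SIDE on [IUTchIII] Cor. 3.12 (S. Mochizuki,
*Inter-universal Teichmüller theory III*, Cor. 3.12 p. 173–174; Step (xi-f) p. 184) or on any author; «refuted as typed» ≠ «refuted in print».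

THE POINT. abc-iut-w5-d009's socket `WRow.not_licence_triple_of_not_hullCell` (`Cor312LicenceTripleHullCellRefute`, p493429) refutes the hull
licence at the `K`-level pilot datum of a genuine Θ-volume datum `T` over the Frey–Legendre point `ratPoint (a/c)` of an abc triple from ONE
failing hull cell (abc-iut-rh-typ-4's floor-exact column `HullCell`, p458452 / p462895) at a tame pole `p ∣ abc`, with the local type
`e(K_{x₀}/ℚ_p) = e₀` PINNED BY HYPOTHESIS at every fibre point. This file removes the hypothesis: at a pole prime `p ∉ {2, 3, 5, l}` the local
type is CONSTANT on the fibre (`K/ℚ` is Galois since `j(a/c) ∈ ℚ`: abc-iut-rh-typ-10's `ramificationIdx_placeOf_eq_of_jInv_mem_range`, p482181)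
and lies in the KERNEL CLASS `e = A·l`, `A ∣ 30`, `15 ∣ A·v_p(abc)`, `v_p(abc)` even ⇒ `A ∣ 15`, `p ∤ e` (abc-iut-W-neg-1's local-type lemmas
p459442 / p461700 / p467688; abc-iut-w4-d087's parity lemma p463720 with abc-iut-W-ref-1's `TameRobust.even_ord_ratPoint_triple`), so failing cells
FOR EVERY CLASS MEMBER refute the licence with NO local-type binder:
* §1 `WRow.absRamificationIdx_kOf_eq_of_ratPoint` (fibre constancy), **`WRow.localType_class_triple`** (the kernel class at a tame pole);
* §2 **`WRow.not_licence_triple_of_hullCells_tame`** — abc triple, ANY level `l`, genuine Θ-volume datum `T` at `(ratPoint (a/c), l)`, pole prime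
  `p ∉ {2, 3, 5, l}` with `v_p(abc) = v`, a label `i + 1 ≤ l⋆`, and FOR EVERY `A` IN THE CLASS a turning point `a₀` with
  `¬ HullCell (A·l) (A·v) (i+1) (⌊A·l/(p−1)⌋+1) (p^{a₀} − a₀·A·l)` ⟹ for EVERY pair of realising ideles `¬ Thm311ToCor312.Licence (settingPrVolSharp …)`;
  **`WRow.not_exists_qPinned_and_hull_triple_of_hullCells_tame`** (branch C's antecedent «∃ ρ qK, QPinned ∧ PilotKummerCompatHull» FAILS, any columns);
  **`GenuineK.not_pilotKummerCompatHull_chosen_triple_of_hullCells_tame`** (the W-lane row shape: CHOSEN realising ideles, pinned reading).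
CONSUMERS (R-W numerics lead's `REF-BANDS-EXACT-CERTS.tsv` «DATUM-BAND» rows) prove only INTEGER cells per class member, uniformly in `l` per
turning-point piece. READING (neutral): a sufficient condition for the per-datum S_H object to FAIL at EVERY genuine datum of the class
`(ratPoint (a/c), l)`; admissibility / Szpiro-badness / (P6) / NON-EMPTINESS of the class are NOT claimed. HONEST SCOPE: OUR sharp containers,
Dupuy–Hilado's typed (Ind1)/(Ind2); STRONGER-THAN-PRINT hull reading; nothing about the printed inequality, the number-level corollary or any
author's intended hull; typed ≠ proved; instantiated ≠ endorsed; no abc claim.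
[cite: Mochizuki2012, IUTchI Def. 3.1 (b),(c) pp. 61–62, Rmk. 3.1.5 p. 65, Ex. 3.2 (iv) p. 71; IUTchIII Cor. 3.12 Step (xi-f) p. 184; IUTchIV Prop. 1.1 p. 9, Prop. 1.2 (i)(ii) p. 10, Thm. 1.10 p. 22, Cor. 2.2 (ii) proof (P5) p. 46]
[cite: DupuyHilado2025, §3.3, §3.4, §4.9, §4.12] [cite: NeukirchANT1999, Ch. I §9 (9.1), Ch. II (5.5)–(5.7)] [cite: SilvermanATAEC1994, V.5 Thm. 5.3 and Cor. 5.4]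
[cite: SilvermanAEC2009, proof of Prop. VII.5.4(c)] [cite: SerreLocalFields1979, Ch. III §6 Prop. 13] [claim: Mochizuki2012, status: disputed] for every IUT sentence.
-/

noncomputable section

open Set Function Metric NumberField IsDedekindDomain

namespace Summit.ABC.IUTFork.Conditional

open Thm311 Thm311.Real Cor312 Cor312Vol Cor312Prov Literature.IUT.LogThetaLattice Literature.IUT.LogVolume
  Literature.IUT.HodgeTheaters Literature.IUT.LogVolume.Cor22 Literature.IUT.LogVolume.ThetaData
open Literature.NumberTheory.NumberFields Literature.NumberTheory.GaloisRepresentations.Ultrametric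
open Literature.NumberTheory.DiophantineGeometry Literature.NumberTheory.DiophantineGeometry.GenEll
open Summit.ABC.IUTFork.Repair.RH.HullThresholdExact Summit.ABC.IUTFork.Repair.RH.HullThresholdExactRefute
open Summit.ABC.IUTFork.Repair.RH.ReachLedgerQ2

/-! ## §1. The local type at a tame pole of an abc triple: constant on the fibre, inside the kernel class -/

/-- **The local type is CONSTANT on the fibre over `p`** for a genuine Θ-volume datum over a RATIONAL point: `e(K_{x₀}/ℚ_p) = e(K_{x₁}/ℚ_p)`
for any two fibre points `x₀, x₁ ∣ p` of `pilotDataOfK T.D T.K` — `K/ℚ` is Galois (`j(q) ∈ ℚ`, abc-iut-rh-typ-10's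
`ramificationIdx_placeOf_eq_of_jInv_mem_range`, p482181: conjugate places ramify together) and `e(K_x/ℚ_p) = e(𝔭_x ∣ p)`
(`absRamificationIdx_rescaledCompletion`). [cite: NeukirchANT1999, Ch. I §9 (9.1)] [cite: Mochizuki2012, IUTchI Rmk. 3.1.5 p. 65] [claim: Mochizuki2012, status: disputed] -/
theorem WRow.absRamificationIdx_kOf_eq_of_ratPoint {q : ℚ} {l : ℕ} (T : Cor22.ThetaVolumeDatumAt (ratPoint q) l) (pp : Nat.Primes) :
    letI := T.instFieldF; letI := T.instNumberFieldF; letI := T.instAlgebraF; letI := T.instFieldK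
    letI := T.instNumberFieldK; letI := T.instAlgebraK; letI := T.instFieldFbar; letI := T.instAlgebraFbar
    letI := T.instAlgebraKFbar; letI := T.instIsElliptic
    haveI : Fact (pp : ℕ).Prime := ⟨pp.2⟩
    ∀ x₀ x₁ : (thetaIndex (pilotDataOfK T.D T.K)).Fibre (.inr pp),
      absRamificationIdx (pp : ℕ) (kOf (pilotDataOfK T.D T.K) pp.1 x₀) = absRamificationIdx (pp : ℕ) (kOf (pilotDataOfK T.D T.K) pp.1 x₁) := by
  letI := T.instFieldF; letI := T.instNumberFieldF; letI := T.instAlgebraF; letI := T.instFieldK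
  letI := T.instNumberFieldK; letI := T.instAlgebraK; letI := T.instFieldFbar; letI := T.instAlgebraFbar
  letI := T.instAlgebraKFbar; letI := T.instIsElliptic
  haveI : Fact (pp : ℕ).Prime := ⟨pp.2⟩
  intro x₀ x₁
  have hj : Cor22.jInv (ratPoint q).x ∈ Set.range (algebraMap ℚ (ratPoint q).F) :=
    ⟨Cor22.jInv q, by change (algebraMap ℚ ℚ) _ = _; exact (eq_ratCast _ _).trans (Rat.cast_id _)⟩
  rw [absRamificationIdx_rescaledCompletion T.K (pp : ℕ) _ (natCast_mem_placeOf (pilotDataOfK T.D T.K) pp.1 x₀),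
    absRamificationIdx_rescaledCompletion T.K (pp : ℕ) _ (natCast_mem_placeOf (pilotDataOfK T.D T.K) pp.1 x₁)]
  exact ramificationIdx_placeOf_eq_of_jInv_mem_range T hj pp x₁ x₀

/-- **The KERNEL CLASS of the local type at a tame pole of an abc triple.** `a + b = c` coprime, `T` a genuine Θ-volume datum at
`(ratPoint (a/c), l)`, a prime `p ∣ abc` with `p ∉ {2, 3, 5, l}` and `v := v_p(abc)` (so `ord_p j(a/c) = −2v`, abc-iut-S6's
`Cor22.ord_jInv_ratPoint_triple_eq`). Then EVERY fibre point `x₀ ∣ p` has `e(K_{x₀}/ℚ_p) = A·l` with `A = e(𝔭_{x₀} ∩ F ∣ p)` (abc-iut-W-neg-1's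
`GenuineK.absRamificationIdx_kOf_eq_mul_prime_ratPoint`: `e(K/F) = l` exactly at bad places) and: `A ∣ 30` (the tame cyclic local type
`ramificationIdx_int_dvd_thirty_mul_ratPoint'`); `15 ∣ A·v` (the `30`-th root of the Tate parameter,
`GenuineK.fifteen_mul_prime_dvd_absRamificationIdx_kOf_mul_ratPoint`); `v` EVEN ⇒ `A ∣ 15` (abc-iut-w4-d087's parity lemma
`GenuineK.absRamificationIdx_kOf_dvd_fifteen_mul_ratPoint`: the Legendre curve is multiplicative at `p` over `ℚ` and `√λ, √(λ−1)` are unramified;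
orders by abc-iut-W-ref-1's `TameRobust.even_ord_ratPoint_triple`); `p ∤ A·l` (tameness, `GenuineK.absRamificationIdx_kOf_dvd_ratPoint`).
[cite: SilvermanATAEC1994, V.5 Thm. 5.3 and Cor. 5.4] [cite: SilvermanAEC2009, proof of Prop. VII.5.4(c)]
[cite: Mochizuki2012, IUTchIV Thm. 1.10 p. 22 and proof Steps (ii)–(iii) p. 24–26] [claim: Mochizuki2012, status: disputed] -/
theorem WRow.localType_class_triple {a b c l : ℕ} (habc : IsABCTriple a b c)
    (T : Cor22.ThetaVolumeDatumAt (ratPoint ((a : ℚ) / c)) l) (pp : Nat.Primes) (hp2 : (pp : ℕ) ≠ 2) (hp3 : (pp : ℕ) ≠ 3)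
    (hp5 : (pp : ℕ) ≠ 5) (hpl : (pp : ℕ) ≠ l) (hpabc : (pp : ℕ) ∣ a * b * c) {v : ℕ} (hv : (a * b * c).factorization pp = v) :
    letI := T.instFieldF; letI := T.instNumberFieldF; letI := T.instAlgebraF; letI := T.instFieldK
    letI := T.instNumberFieldK; letI := T.instAlgebraK; letI := T.instFieldFbar; letI := T.instAlgebraFbar
    letI := T.instAlgebraKFbar; letI := T.instIsElliptic
    haveI : Fact (pp : ℕ).Prime := ⟨pp.2⟩
    ∀ x₀ : (thetaIndex (pilotDataOfK T.D T.K)).Fibre (.inr pp),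
      ∃ A : ℕ, absRamificationIdx (pp : ℕ) (kOf (pilotDataOfK T.D T.K) pp.1 x₀) = A * l ∧
        A ∣ 30 ∧ 15 ∣ A * v ∧ (Even v → A ∣ 15) ∧ ¬ (pp : ℕ) ∣ A * l := by
  letI := T.instFieldF; letI := T.instNumberFieldF; letI := T.instAlgebraF; letI := T.instFieldK
  letI := T.instNumberFieldK; letI := T.instAlgebraK; letI := T.instFieldFbar; letI := T.instAlgebraFbar
  letI := T.instAlgebraKFbar; letI := T.instIsElliptic
  haveI : Fact (pp : ℕ).Prime := ⟨pp.2⟩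
  intro x₀
  have habc0 : a * b * c ≠ 0 := by
    have ha : 0 < a := habc.1; have hb : 0 < b := habc.2.1; have hc : 0 < c := by have := habc.2.2.1; omega
    positivity
  have hv0 : 0 < v := by rw [← hv]; exact Nat.Prime.factorization_pos_of_dvd pp.2 habc0 hpabc
  have hl0 : 0 < l := by have := T.D.five_le_l; omega
  -- the pole of `j(a/c)` below every place over `p`
  have hpole : ∀ u : HeightOneSpectrum (𝓞 ℚ), Rat.HeightOneSpectrum.natGenerator u = (pp : ℕ) →
      ord ℚ u (Cor22.jInv ((a : ℚ) / c)) = -(2 * ((v : ℕ) : ℤ)) := by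
    intro u hu
    rw [Cor22.ord_jInv_ratPoint_triple_eq habc u (by rw [hu]; exact hp2) (by rw [hu]; exact hpabc), hu, hv]
  have hpole' : ∀ u : HeightOneSpectrum (𝓞 ℚ), Rat.HeightOneSpectrum.natGenerator u = (pp : ℕ) →
      ord ℚ u (Cor22.jInv ((a : ℚ) / c)) < 0 := fun u hu => by
    rw [hpole u hu]
    have : (0 : ℤ) < v := by exact_mod_cast hv0
    linarith
  -- `e = e(w|p)·l`
  have hmul := GenuineK.absRamificationIdx_kOf_eq_mul_prime_ratPoint T pp hp2 hpl hpole' x₀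
  obtain ⟨A, hA⟩ : ∃ A : ℕ, absRamificationIdx (pp : ℕ) (kOf (pilotDataOfK T.D T.K) pp.1 x₀) = A * l := ⟨_, hmul⟩
  have hpw : ((pp : ℕ) : 𝓞 T.K) ∈ (placeOf (pilotDataOfK T.D T.K) pp.1 x₀).asIdeal := natCast_mem_placeOf (pilotDataOfK T.D T.K) pp.1 x₀
  have hwchar : residueChar T.K (placeOf (pilotDataOfK T.D T.K) pp.1 x₀) = (pp : ℕ) := residueChar_eq_of_natCast_mem pp.1 hpw
  have heK : absRamificationIdx (pp : ℕ) (kOf (pilotDataOfK T.D T.K) pp.1 x₀) =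
      (placeOf (pilotDataOfK T.D T.K) pp.1 x₀).asIdeal.ramificationIdx ℤ :=
    absRamificationIdx_rescaledCompletion T.K (pp : ℕ) _ hpw
  have hnot : (pp : ℕ) ∉ ({2, 3, 5, l} : Finset ℕ) := by
    simp only [Finset.mem_insert, Finset.mem_singleton, not_or]
    exact ⟨hp2, hp3, hp5, hpl⟩
  refine ⟨A, hA, ?_, ?_, ?_, ?_⟩
  · -- `A ∣ 30`: `e ∣ 30·l`
    have hdvd : (placeOf (pilotDataOfK T.D T.K) pp.1 x₀).asIdeal.ramificationIdx ℤ ∣ 30 * l :=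
      T.ramificationIdx_int_dvd_thirty_mul_ratPoint' hnot hpole' _ hwchar
    rw [← heK, hA] at hdvd
    exact Nat.dvd_of_mul_dvd_mul_right hl0 hdvd
  · -- `15 ∣ A·v`: `15·l ∣ e·v`
    have h15 : 15 * l ∣ absRamificationIdx (pp : ℕ) (kOf (pilotDataOfK T.D T.K) pp.1 x₀) * v :=
      GenuineK.fifteen_mul_prime_dvd_absRamificationIdx_kOf_mul_ratPoint T pp hp2 hpl hv0 hpole x₀
    rw [hA, show A * l * v = A * v * l by ring] at h15
    exact Nat.dvd_of_mul_dvd_mul_right hl0 h15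
  · -- `v` even ⇒ `A ∣ 15` (parity local type)
    intro heven
    have hq0 : (a : ℚ) / c ≠ 0 := T.inU.1
    have hq1 : (a : ℚ) / c ≠ 1 := T.inU.2
    have hev2 : ∀ u : HeightOneSpectrum (𝓞 ℚ), Rat.HeightOneSpectrum.natGenerator u = (pp : ℕ) →
        Even (ord ℚ u ((a : ℚ) / c)) ∧ Even (ord ℚ u ((a : ℚ) / c - 1)) :=
      fun u hu => TameRobust.even_ord_ratPoint_triple habc pp.2 (hv ▸ heven) u hu
    have hev : ∀ u : HeightOneSpectrum (𝓞 ℚ), Rat.HeightOneSpectrum.natGenerator u = (pp : ℕ) →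
        ∃ m : ℤ, u.valuation ℚ ((a : ℚ) / c) = WithZero.exp (2 * m) := fun u hu =>
      TameRobust.exists_valuation_eq_exp_two_mul_of_even_ord u hq0 (hev2 u hu).1
    have hev1 : ∀ u : HeightOneSpectrum (𝓞 ℚ), Rat.HeightOneSpectrum.natGenerator u = (pp : ℕ) →
        ∃ m : ℤ, u.valuation ℚ ((a : ℚ) / c - 1) = WithZero.exp (2 * m) := fun u hu =>
      TameRobust.exists_valuation_eq_exp_two_mul_of_even_ord u (sub_ne_zero.mpr hq1) (hev2 u hu).2
    obtain ⟨hd, -⟩ := GenuineK.absRamificationIdx_kOf_dvd_fifteen_mul_ratPoint T pp hp2 hp3 hp5 hpl hpole' hev hev1 x₀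
    rw [hA] at hd
    exact Nat.dvd_of_mul_dvd_mul_right hl0 hd
  · -- tameness
    rw [← hA]
    exact (GenuineK.absRamificationIdx_kOf_dvd_ratPoint T pp hp2 hp3 hp5 hpl hpole' x₀).2

/-! ## §2. The class-robust socket: failing cells for every class member refute the licence, with NO local-type hypothesis -/

/-- **THE HULL LICENCE FAILS AT THE `K`-LEVEL DATUM OF AN abc TRIPLE WHEN R-H ROW 4's COLUMN FAILS AT A TAME POLE FOR EVERY MEMBER OF THE
KERNEL CLASS OF LOCAL TYPES.** `a + b = c` an abc triple, `l` any level, `T` a genuine Θ-volume datum at `(ratPoint (a/c), l)`, ideles REALISING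
the pilot divisors of `X := pilotDataOfK T.D T.K`; a prime `p ∣ abc`, `p ∉ {2, 3, 5, l}`, `v := v_p(abc)`; a label `i + 1 ≤ (l−1)/2`; and for EVERY
`A` with `A ∣ 30`, `15 ∣ A·v`, (`v` even ⇒ `A ∣ 15`) a turning point `a₀` of `A·l` with `¬ HullCell (A·l) (A·v) (i+1) (⌊A·l/(p−1)⌋+1) (p^{a₀} − a₀·A·l)`.
THEN `¬ Thm311ToCor312.Licence (settingPrVolSharp X …)`: the local type of one fibre point lies in the class and is the local type of EVERY fibre
point (§1), so abc-iut-w5-d009's pinned socket `WRow.not_licence_triple_of_not_hullCell` (p493429) applies with `(e₀, P) = (A·l, A·v)`.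
[cite: Mochizuki2012, IUTchI Ex. 3.2 (iv) p. 71; IUTchIII Cor. 3.12 Step (xi-f) p. 184; IUTchIV Prop. 1.1 p. 9, Prop. 1.2 (i)(ii) p. 10, Cor. 2.2 (ii) proof (P5) p. 46]
[cite: DupuyHilado2025, §3.4, §4.9, §4.12] [cite: SerreLocalFields1979, Ch. III §6 Prop. 13] [claim: Mochizuki2012, status: disputed] -/
theorem WRow.not_licence_triple_of_hullCells_tame {a b c l : ℕ} (habc : IsABCTriple a b c)
    (T : Cor22.ThetaVolumeDatumAt (ratPoint ((a : ℚ) / c)) l) (pp : Nat.Primes) (hp2 : (pp : ℕ) ≠ 2) (hp3 : (pp : ℕ) ≠ 3)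
    (hp5 : (pp : ℕ) ≠ 5) (hpl : (pp : ℕ) ≠ l) (hpabc : (pp : ℕ) ∣ a * b * c) {v : ℕ} (hv : (a * b * c).factorization pp = v)
    {i : ℕ} (hi : i + 1 ≤ (l - 1) / 2)
    (hcell : ∀ A : ℕ, A ∣ 30 → 15 ∣ A * v → (Even v → A ∣ 15) →
      ∃ a₀ : ℕ, (∀ s : ℕ, s < a₀ → (1 : ℤ) * ((pp : ℕ) : ℤ) ^ s * (((pp : ℕ) : ℤ) - 1) < ((A * l : ℕ) : ℤ)) ∧
        ((A * l : ℕ) : ℤ) ≤ 1 * ((pp : ℕ) : ℤ) ^ a₀ * (((pp : ℕ) : ℤ) - 1) ∧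
        ¬ HullCell ((A * l : ℕ) : ℤ) ((A * v : ℕ) : ℤ) ((i : ℤ) + 1) (((A * l) / ((pp : ℕ) - 1) + 1 : ℕ) : ℤ)
          (((pp : ℕ) : ℤ) ^ a₀ - (a₀ : ℤ) * ((A * l : ℕ) : ℤ))) :
    letI := T.instFieldF; letI := T.instNumberFieldF; letI := T.instAlgebraF; letI := T.instFieldK
    letI := T.instNumberFieldK; letI := T.instAlgebraK; letI := T.instFieldFbar; letI := T.instAlgebraFbar
    letI := T.instAlgebraKFbar; letI := T.instIsElliptic
    ∀ {logv : PadicLogs T.K} (hlog : LogvAnalytic logv) (M : Type) [Field M] [NumberField M]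
      (archPk : ∀ (j : (thetaIndex (pilotDataOfK T.D T.K)).Label) (vQ : (thetaIndex (pilotDataOfK T.D T.K)).VQ),
        Set ((logShellsDH (pilotDataOfK T.D T.K) logv).Packet j vQ))
      (archSub : ∀ (j : (thetaIndex (pilotDataOfK T.D T.K)).Label) (v : (thetaIndex (pilotDataOfK T.D T.K)).V),
        Set ((logShellsDH (pilotDataOfK T.D T.K) logv).Packet j ((thetaIndex (pilotDataOfK T.D T.K)).over v)))
      (Ψ : ℤ → ∀ v : (thetaIndex (pilotDataOfK T.D T.K)).V, v ∈ (thetaIndex (pilotDataOfK T.D T.K)).Vbad →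
        Set ((logShellsDH (pilotDataOfK T.D T.K) logv).StarPacket v))
      (act : ℤ → ∀ v : (thetaIndex (pilotDataOfK T.D T.K)).V, v ∈ (thetaIndex (pilotDataOfK T.D T.K)).Vbad →
        (logShellsDH (pilotDataOfK T.D T.K) logv).StarPacket v → Module.End ℚ ((logShellsDH (pilotDataOfK T.D T.K) logv).StarPacket v))
      (Mmod : ℤ → ∀ j : (thetaIndex (pilotDataOfK T.D T.K)).LabelStar, Set ((logShellsDH (pilotDataOfK T.D T.K) logv).GlobalPacket j.1))
      (region : ℤ → ∀ j : (thetaIndex (pilotDataOfK T.D T.K)).LabelStar, FinDivisor M → ∀ vQ : (thetaIndex (pilotDataOfK T.D T.K)).VQ,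
        Set ((logShellsDH (pilotDataOfK T.D T.K) logv).Packet j.1 vQ))
      (n : ℤ) {HT : Type} {LogLink : HT → HT → Type} {IsFull : ∀ {s t : HT}, LogLink s t → Prop}
      (lat : LGPGaussianLogThetaLattice LogLink IsFull)
      {Frd : Type} {IsoF : Frd → Frd → Type} {Ob : Frd → Type} {realify : Frd → Frd} {Strip : Type}
      {IsoS : Strip → Strip → Type} {Mv : ∀ v : (thetaIndex (pilotDataOfK T.D T.K)).V, v ∈ (thetaIndex (pilotDataOfK T.D T.K)).Vbad → Type}
      [∀ v h, Monoid (Mv v h)]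
      (sig : GlobalLGPFrobenioidSignature (thetaIndex (pilotDataOfK T.D T.K)).lstar (thetaIndex (pilotDataOfK T.D T.K)).V
        (· ∈ (thetaIndex (pilotDataOfK T.D T.K)).Vbad) Frd IsoF Ob realify Strip IsoS Mv)
      (split : SplittingMonoids Mv) {ObΔ : Type} {N : ∀ v : (thetaIndex (pilotDataOfK T.D T.K)).V, v ∈ (thetaIndex (pilotDataOfK T.D T.K)).Vbad → Type}
      [∀ v h, Monoid (N v h)] (qData : QPilotData ObΔ N)
      (tq : ∀ (pp : Nat.Primes) (x : (thetaIndex (pilotDataOfK T.D T.K)).Fibre (.inr pp)),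
        haveI : Fact (pp : ℕ).Prime := ⟨pp.2⟩; kOf (pilotDataOfK T.D T.K) pp.1 x)
      (t : ∀ (pp : Nat.Primes) (_ : Fin (pilotDataOfK T.D T.K).lstar) (x : (thetaIndex (pilotDataOfK T.D T.K)).Fibre (.inr pp)),
        haveI : Fact (pp : ℕ).Prime := ⟨pp.2⟩; kOf (pilotDataOfK T.D T.K) pp.1 x)
      (htq0 : ∀ pp x, tq pp x ≠ 0)
      (htq1 : ∀ (pp : Nat.Primes) (x : (thetaIndex (pilotDataOfK T.D T.K)).Fibre (.inr pp)),
        haveI : Fact (pp : ℕ).Prime := ⟨pp.2⟩; placeOf (pilotDataOfK T.D T.K) pp.1 x ∉ (pilotDataOfK T.D T.K).S → ‖tq pp x‖ = 1)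
      (_ht0 : ∀ pp i x, t pp i x ≠ 0)
      (_ht : ∀ (pp : Nat.Primes) (i : Fin (pilotDataOfK T.D T.K).lstar) (x : (thetaIndex (pilotDataOfK T.D T.K)).Fibre (.inr pp)),
        haveI : Fact (pp : ℕ).Prime := ⟨pp.2⟩
        Real.log ‖t pp i x‖ = -((pilotDataOfK T.D T.K).thetaPilot i (placeOf (pilotDataOfK T.D T.K) pp.1 x)) *
          logNorm T.K (placeOf (pilotDataOfK T.D T.K) pp.1 x) / localDegree T.K (placeOf (pilotDataOfK T.D T.K) pp.1 x))
      (_htq : ∀ (pp : Nat.Primes) (x : (thetaIndex (pilotDataOfK T.D T.K)).Fibre (.inr pp)),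
        haveI : Fact (pp : ℕ).Prime := ⟨pp.2⟩
        Real.log ‖tq pp x‖ = -((pilotDataOfK T.D T.K).qPilot (placeOf (pilotDataOfK T.D T.K) pp.1 x)) *
          logNorm T.K (placeOf (pilotDataOfK T.D T.K) pp.1 x) / localDegree T.K (placeOf (pilotDataOfK T.D T.K) pp.1 x)),
      ¬ Thm311ToCor312.Licence
        (settingPrVolSharp (pilotDataOfK T.D T.K) hlog M archPk archSub Ψ act Mmod region n lat sig split qData tq t htq0 htq1) := by
  letI := T.instFieldF; letI := T.instNumberFieldF; letI := T.instAlgebraF; letI := T.instFieldK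
  letI := T.instNumberFieldK; letI := T.instAlgebraK; letI := T.instFieldFbar; letI := T.instAlgebraFbar
  letI := T.instAlgebraKFbar; letI := T.instIsElliptic
  haveI : Fact (pp : ℕ).Prime := ⟨pp.2⟩
  intro logv hlog M _ _ archPk archSub Ψ act Mmod region n HT LogLink IsFull lat Frd IsoF Ob realify Strip
    IsoS Mv _ sig split ObΔ N _ qData tq t htq0 htq1 ht0 ht htq
  obtain ⟨u, hu⟩ := (thetaIndex (pilotDataOfK T.D T.K)).fibre_nonempty (.inr pp)
  obtain ⟨A, hA, h30, h15, hpar, hpe⟩ := WRow.localType_class_triple habc T pp hp2 hp3 hp5 hpl hpabc hv ⟨u, hu⟩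
  obtain ⟨a₀, hlo, hhi, hneg⟩ := hcell A h30 h15 hpar
  have hloc : letI := T.instFieldF; letI := T.instNumberFieldF; letI := T.instAlgebraF; letI := T.instFieldK
      letI := T.instNumberFieldK; letI := T.instAlgebraK; letI := T.instFieldFbar; letI := T.instAlgebraFbar
      letI := T.instAlgebraKFbar; letI := T.instIsElliptic
      haveI : Fact (pp : ℕ).Prime := ⟨pp.2⟩
      ∀ x₀ : (thetaIndex (pilotDataOfK T.D T.K)).Fibre (.inr pp),
        absRamificationIdx (pp : ℕ) (kOf (pilotDataOfK T.D T.K) pp.1 x₀) = A * l := fun x₀ =>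
    (WRow.absRamificationIdx_kOf_eq_of_ratPoint T pp x₀ ⟨u, hu⟩).trans hA
  exact WRow.not_licence_triple_of_not_hullCell habc T pp hp2 hpl hpabc (e₀ := A * l) (P := A * v) (i := i) (a₀ := a₀) hpe hloc
    (by rw [hv]; ring) hi hlo hhi hneg hlog M archPk archSub Ψ act Mmod region n lat sig split qData tq t htq0 htq1 ht0 ht htq

/-- **… hence BRANCH C's PER-DATUM ANTECEDENT FAILS** under the same class-cell hypotheses: NO `ρ`, `qK` with `QPinned ∧ PilotKummerCompatHull`
at `settingPrVolSharp (pilotDataOfK T.D T.K) …`, for ANY columns and EVERY pair of realising ideles (the binder shape of `hSHw`/`hSHwBad`,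
p453137 / p450130; abc-iut-w5-d009's `exists_qPinned_and_hull_settingPrVolSharp_iff_licence`, realising q-ideles have norm `≤ 1`).
[cite: Mochizuki2012, IUTchIII Cor. 3.12 Step (xi-d) p. 183, (xi-f) p. 184] [cite: DupuyHilado2025, §3.4, §4.9, §4.12] [claim: Mochizuki2012, status: disputed] -/
theorem WRow.not_exists_qPinned_and_hull_triple_of_hullCells_tame {a b c l : ℕ} (habc : IsABCTriple a b c)
    (T : Cor22.ThetaVolumeDatumAt (ratPoint ((a : ℚ) / c)) l) (pp : Nat.Primes) (hp2 : (pp : ℕ) ≠ 2) (hp3 : (pp : ℕ) ≠ 3)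
    (hp5 : (pp : ℕ) ≠ 5) (hpl : (pp : ℕ) ≠ l) (hpabc : (pp : ℕ) ∣ a * b * c) {v : ℕ} (hv : (a * b * c).factorization pp = v)
    {i : ℕ} (hi : i + 1 ≤ (l - 1) / 2)
    (hcell : ∀ A : ℕ, A ∣ 30 → 15 ∣ A * v → (Even v → A ∣ 15) →
      ∃ a₀ : ℕ, (∀ s : ℕ, s < a₀ → (1 : ℤ) * ((pp : ℕ) : ℤ) ^ s * (((pp : ℕ) : ℤ) - 1) < ((A * l : ℕ) : ℤ)) ∧
        ((A * l : ℕ) : ℤ) ≤ 1 * ((pp : ℕ) : ℤ) ^ a₀ * (((pp : ℕ) : ℤ) - 1) ∧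
        ¬ HullCell ((A * l : ℕ) : ℤ) ((A * v : ℕ) : ℤ) ((i : ℤ) + 1) (((A * l) / ((pp : ℕ) - 1) + 1 : ℕ) : ℤ)
          (((pp : ℕ) : ℤ) ^ a₀ - (a₀ : ℤ) * ((A * l : ℕ) : ℤ))) :
    letI := T.instFieldF; letI := T.instNumberFieldF; letI := T.instAlgebraF; letI := T.instFieldK
    letI := T.instNumberFieldK; letI := T.instAlgebraK; letI := T.instFieldFbar; letI := T.instAlgebraFbar
    letI := T.instAlgebraKFbar; letI := T.instIsElliptic
    ∀ {logv : PadicLogs T.K} (hlog : LogvAnalytic logv) (M : Type) [Field M] [NumberField M]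
      (archPk : ∀ (j : (thetaIndex (pilotDataOfK T.D T.K)).Label) (vQ : (thetaIndex (pilotDataOfK T.D T.K)).VQ),
        Set ((logShellsDH (pilotDataOfK T.D T.K) logv).Packet j vQ))
      (archSub : ∀ (j : (thetaIndex (pilotDataOfK T.D T.K)).Label) (v : (thetaIndex (pilotDataOfK T.D T.K)).V),
        Set ((logShellsDH (pilotDataOfK T.D T.K) logv).Packet j ((thetaIndex (pilotDataOfK T.D T.K)).over v)))
      (Ψ : ℤ → ∀ v : (thetaIndex (pilotDataOfK T.D T.K)).V, v ∈ (thetaIndex (pilotDataOfK T.D T.K)).Vbad →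
        Set ((logShellsDH (pilotDataOfK T.D T.K) logv).StarPacket v))
      (act : ℤ → ∀ v : (thetaIndex (pilotDataOfK T.D T.K)).V, v ∈ (thetaIndex (pilotDataOfK T.D T.K)).Vbad →
        (logShellsDH (pilotDataOfK T.D T.K) logv).StarPacket v → Module.End ℚ ((logShellsDH (pilotDataOfK T.D T.K) logv).StarPacket v))
      (Mmod : ℤ → ∀ j : (thetaIndex (pilotDataOfK T.D T.K)).LabelStar, Set ((logShellsDH (pilotDataOfK T.D T.K) logv).GlobalPacket j.1))
      (region : ℤ → ∀ j : (thetaIndex (pilotDataOfK T.D T.K)).LabelStar, FinDivisor M → ∀ vQ : (thetaIndex (pilotDataOfK T.D T.K)).VQ,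
        Set ((logShellsDH (pilotDataOfK T.D T.K) logv).Packet j.1 vQ))
      (n : ℤ) {HT : Type} {LogLink : HT → HT → Type} {IsFull : ∀ {s t : HT}, LogLink s t → Prop}
      (lat : LGPGaussianLogThetaLattice LogLink IsFull)
      {Frd : Type} {IsoF : Frd → Frd → Type} {Ob : Frd → Type} {realify : Frd → Frd} {Strip : Type}
      {IsoS : Strip → Strip → Type} {Mv : ∀ v : (thetaIndex (pilotDataOfK T.D T.K)).V, v ∈ (thetaIndex (pilotDataOfK T.D T.K)).Vbad → Type}
      [∀ v h, Monoid (Mv v h)]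
      (sig : GlobalLGPFrobenioidSignature (thetaIndex (pilotDataOfK T.D T.K)).lstar (thetaIndex (pilotDataOfK T.D T.K)).V
        (· ∈ (thetaIndex (pilotDataOfK T.D T.K)).Vbad) Frd IsoF Ob realify Strip IsoS Mv)
      (split : SplittingMonoids Mv) {ObΔ : Type} {N : ∀ v : (thetaIndex (pilotDataOfK T.D T.K)).V, v ∈ (thetaIndex (pilotDataOfK T.D T.K)).Vbad → Type}
      [∀ v h, Monoid (N v h)] (qData : QPilotData ObΔ N)
      (tq : ∀ (pp : Nat.Primes) (x : (thetaIndex (pilotDataOfK T.D T.K)).Fibre (.inr pp)),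
        haveI : Fact (pp : ℕ).Prime := ⟨pp.2⟩; kOf (pilotDataOfK T.D T.K) pp.1 x)
      (t : ∀ (pp : Nat.Primes) (_ : Fin (pilotDataOfK T.D T.K).lstar) (x : (thetaIndex (pilotDataOfK T.D T.K)).Fibre (.inr pp)),
        haveI : Fact (pp : ℕ).Prime := ⟨pp.2⟩; kOf (pilotDataOfK T.D T.K) pp.1 x)
      (htq0 : ∀ pp x, tq pp x ≠ 0)
      (htq1 : ∀ (pp : Nat.Primes) (x : (thetaIndex (pilotDataOfK T.D T.K)).Fibre (.inr pp)),
        haveI : Fact (pp : ℕ).Prime := ⟨pp.2⟩; placeOf (pilotDataOfK T.D T.K) pp.1 x ∉ (pilotDataOfK T.D T.K).S → ‖tq pp x‖ = 1)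
      (col : ℤ → Column (logShellsDH (pilotDataOfK T.D T.K) logv))
      (_ht0 : ∀ pp i x, t pp i x ≠ 0)
      (_ht : ∀ (pp : Nat.Primes) (i : Fin (pilotDataOfK T.D T.K).lstar) (x : (thetaIndex (pilotDataOfK T.D T.K)).Fibre (.inr pp)),
        haveI : Fact (pp : ℕ).Prime := ⟨pp.2⟩
        Real.log ‖t pp i x‖ = -((pilotDataOfK T.D T.K).thetaPilot i (placeOf (pilotDataOfK T.D T.K) pp.1 x)) *
          logNorm T.K (placeOf (pilotDataOfK T.D T.K) pp.1 x) / localDegree T.K (placeOf (pilotDataOfK T.D T.K) pp.1 x))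
      (_htq : ∀ (pp : Nat.Primes) (x : (thetaIndex (pilotDataOfK T.D T.K)).Fibre (.inr pp)),
        haveI : Fact (pp : ℕ).Prime := ⟨pp.2⟩
        Real.log ‖tq pp x‖ = -((pilotDataOfK T.D T.K).qPilot (placeOf (pilotDataOfK T.D T.K) pp.1 x)) *
          logNorm T.K (placeOf (pilotDataOfK T.D T.K) pp.1 x) / localDegree T.K (placeOf (pilotDataOfK T.D T.K) pp.1 x)),
      ¬ ∃ (ρ : (∀ v : (thetaIndex (pilotDataOfK T.D T.K)).V, v ∈ (thetaIndex (pilotDataOfK T.D T.K)).Vbad →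
              Set ((logShellsDH (pilotDataOfK T.D T.K) logv).StarPacket v)) →
            ∀ (j : (thetaIndex (pilotDataOfK T.D T.K)).Label) (vQ : (thetaIndex (pilotDataOfK T.D T.K)).VQ),
              Set ((logShellsDH (pilotDataOfK T.D T.K) logv).Packet j vQ))
          (qK : ∀ v : (thetaIndex (pilotDataOfK T.D T.K)).V, v ∈ (thetaIndex (pilotDataOfK T.D T.K)).Vbad →
            Set ((logShellsDH (pilotDataOfK T.D T.K) logv).StarPacket v)),
          QPinned ({ toSituation := situationPrVol (pilotDataOfK T.D T.K) hlog M archPk archSub Ψ act Mmod region, col := col } :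
              LatticeSituation (thetaIndex (pilotDataOfK T.D T.K)))
            (settingPrVolSharp (pilotDataOfK T.D T.K) hlog M archPk archSub Ψ act Mmod region n lat sig split qData tq t htq0 htq1) ρ qK ∧
          PilotKummerCompatHull ({ toSituation := situationPrVol (pilotDataOfK T.D T.K) hlog M archPk archSub Ψ act Mmod region, col := col } :
              LatticeSituation (thetaIndex (pilotDataOfK T.D T.K)))
            (settingPrVolSharp (pilotDataOfK T.D T.K) hlog M archPk archSub Ψ act Mmod region n lat sig split qData tq t htq0 htq1) ρ qK := by
  letI := T.instFieldF; letI := T.instNumberFieldF; letI := T.instAlgebraF; letI := T.instFieldK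
  letI := T.instNumberFieldK; letI := T.instAlgebraK; letI := T.instFieldFbar; letI := T.instAlgebraFbar
  letI := T.instAlgebraKFbar; letI := T.instIsElliptic
  intro logv hlog M _ _ archPk archSub Ψ act Mmod region n HT LogLink IsFull lat Frd IsoF Ob realify Strip
    IsoS Mv _ sig split ObΔ N _ qData tq t htq0 htq1 col ht0 ht htq h
  have hL := (exists_qPinned_and_hull_settingPrVolSharp_iff_licence (pilotDataOfK T.D T.K) hlog M archPk archSub Ψ act Mmod region n
    lat sig split qData tq t htq0 htq1 col (fun pp x => norm_qIdele_le_one_of_realises (pilotDataOfK T.D T.K) tq htq0 htq pp x)).1 h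
  exact WRow.not_licence_triple_of_hullCells_tame habc T pp hp2 hp3 hp5 hpl hpabc hv hi hcell hlog M archPk archSub Ψ act Mmod
    region n lat sig split qData tq t htq0 htq1 ht0 ht htq hL

/-- **… and in the INSTANCE SHAPE of the W-lane row theorems** (the per-datum object of the window binders `hSHw`/`hSHwBad`): for every genuine
Θ-volume datum `T` over `(ratPoint (a/c), l)` and EVERY choice of the free context binders and Kummer datum, `Cor312Vol.PilotKummerCompatHull` at
`settingPrVolSharp (pilotDataOfK T.D T.K) …` with the CHOSEN realising ideles and the PINNED reading FAILS, under the class-cell hypotheses alone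
(the q-pin holds by `rfl`, abc-iut-c312-1's `licence_of_pilotKummerCompatHull`). «refuted as typed» ≠ «refuted in print».
[cite: Mochizuki2012, IUTchIII Cor. 3.12 Step (xi-f) p. 184; IUTchIV Prop. 1.2 (i)(ii) p. 10] [cite: DupuyHilado2025, §3.4, §4.9] [claim: Mochizuki2012, status: disputed] -/
theorem GenuineK.not_pilotKummerCompatHull_chosen_triple_of_hullCells_tame {a b c l : ℕ} (habc : IsABCTriple a b c)
    (T : Cor22.ThetaVolumeDatumAt (ratPoint ((a : ℚ) / c)) l) (pp : Nat.Primes) (hp2 : (pp : ℕ) ≠ 2) (hp3 : (pp : ℕ) ≠ 3)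
    (hp5 : (pp : ℕ) ≠ 5) (hpl : (pp : ℕ) ≠ l) (hpabc : (pp : ℕ) ∣ a * b * c) {v : ℕ} (hv : (a * b * c).factorization pp = v)
    {i : ℕ} (hi : i + 1 ≤ (l - 1) / 2)
    (hcell : ∀ A : ℕ, A ∣ 30 → 15 ∣ A * v → (Even v → A ∣ 15) →
      ∃ a₀ : ℕ, (∀ s : ℕ, s < a₀ → (1 : ℤ) * ((pp : ℕ) : ℤ) ^ s * (((pp : ℕ) : ℤ) - 1) < ((A * l : ℕ) : ℤ)) ∧
        ((A * l : ℕ) : ℤ) ≤ 1 * ((pp : ℕ) : ℤ) ^ a₀ * (((pp : ℕ) : ℤ) - 1) ∧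
        ¬ HullCell ((A * l : ℕ) : ℤ) ((A * v : ℕ) : ℤ) ((i : ℤ) + 1) (((A * l) / ((pp : ℕ) - 1) + 1 : ℕ) : ℤ)
          (((pp : ℕ) : ℤ) ^ a₀ - (a₀ : ℤ) * ((A * l : ℕ) : ℤ))) :
    letI := T.instFieldF; letI := T.instNumberFieldF; letI := T.instAlgebraF; letI := T.instFieldK
    letI := T.instNumberFieldK; letI := T.instAlgebraK; letI := T.instFieldFbar; letI := T.instAlgebraFbar
    letI := T.instAlgebraKFbar; letI := T.instIsElliptic
    ∀ (M : Type) [Field M] [NumberField M]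
      (archPk : ∀ (j : (thetaIndex (pilotDataOfK T.D T.K)).Label) (vQ : (thetaIndex (pilotDataOfK T.D T.K)).VQ),
        Set ((logShellsDH (pilotDataOfK T.D T.K) (analyticLogv T.K)).Packet j vQ))
      (archSub : ∀ (j : (thetaIndex (pilotDataOfK T.D T.K)).Label) (v : (thetaIndex (pilotDataOfK T.D T.K)).V),
        Set ((logShellsDH (pilotDataOfK T.D T.K) (analyticLogv T.K)).Packet j ((thetaIndex (pilotDataOfK T.D T.K)).over v)))
      (Ψ : ℤ → ∀ v : (thetaIndex (pilotDataOfK T.D T.K)).V, v ∈ (thetaIndex (pilotDataOfK T.D T.K)).Vbad →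
        Set ((logShellsDH (pilotDataOfK T.D T.K) (analyticLogv T.K)).StarPacket v))
      (act : ℤ → ∀ v : (thetaIndex (pilotDataOfK T.D T.K)).V, v ∈ (thetaIndex (pilotDataOfK T.D T.K)).Vbad →
        (logShellsDH (pilotDataOfK T.D T.K) (analyticLogv T.K)).StarPacket v →
          Module.End ℚ ((logShellsDH (pilotDataOfK T.D T.K) (analyticLogv T.K)).StarPacket v))
      (Mmod : ℤ → ∀ j : (thetaIndex (pilotDataOfK T.D T.K)).LabelStar,
        Set ((logShellsDH (pilotDataOfK T.D T.K) (analyticLogv T.K)).GlobalPacket j.1))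
      (region : ℤ → ∀ j : (thetaIndex (pilotDataOfK T.D T.K)).LabelStar, FinDivisor M →
        ∀ vQ : (thetaIndex (pilotDataOfK T.D T.K)).VQ, Set ((logShellsDH (pilotDataOfK T.D T.K) (analyticLogv T.K)).Packet j.1 vQ))
      (frobAdm : ℤ → ℤ → ∀ (j : (thetaIndex (pilotDataOfK T.D T.K)).Label) (vQ : (thetaIndex (pilotDataOfK T.D T.K)).VQ),
        Set ((logShellsDH (pilotDataOfK T.D T.K) (analyticLogv T.K)).Packet j vQ) → Prop)
      (frobLogvol : ℤ → ℤ → ∀ (j : (thetaIndex (pilotDataOfK T.D T.K)).Label) (vQ : (thetaIndex (pilotDataOfK T.D T.K)).VQ),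
        Set ((logShellsDH (pilotDataOfK T.D T.K) (analyticLogv T.K)).Packet j vQ) → ℝ)
      (frobΨ : ℤ → ℤ → ∀ v : (thetaIndex (pilotDataOfK T.D T.K)).V, v ∈ (thetaIndex (pilotDataOfK T.D T.K)).Vbad →
        Set ((logShellsDH (pilotDataOfK T.D T.K) (analyticLogv T.K)).StarPacket v))
      (frobMmod : ℤ → ℤ → ∀ j : (thetaIndex (pilotDataOfK T.D T.K)).LabelStar,
        Set ((logShellsDH (pilotDataOfK T.D T.K) (analyticLogv T.K)).GlobalPacket j.1))
      (unitImage : ℤ → ℤ → ℕ → ∀ (j : (thetaIndex (pilotDataOfK T.D T.K)).Label) (vQ : (thetaIndex (pilotDataOfK T.D T.K)).VQ),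
        Set ((logShellsDH (pilotDataOfK T.D T.K) (analyticLogv T.K)).Packet j vQ))
      (ballImage : ℤ → ℤ → ∀ (j : (thetaIndex (pilotDataOfK T.D T.K)).Label) (vQ : (thetaIndex (pilotDataOfK T.D T.K)).VQ),
        Set ((logShellsDH (pilotDataOfK T.D T.K) (analyticLogv T.K)).Packet j vQ))
      (thetaDiv : ℤ → ℤ → LgpDivisor M (thetaIndex (pilotDataOfK T.D T.K)).lstar)
      (n : ℤ) {HT : Type} {LogLink : HT → HT → Type} {IsFull : ∀ {s t : HT}, LogLink s t → Prop}
      (lat : LGPGaussianLogThetaLattice LogLink IsFull)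
      {Frd : Type} {IsoF : Frd → Frd → Type} {Ob : Frd → Type} {realify : Frd → Frd} {Strip : Type}
      {IsoS : Strip → Strip → Type} {Mv : ∀ v : (thetaIndex (pilotDataOfK T.D T.K)).V, v ∈ (thetaIndex (pilotDataOfK T.D T.K)).Vbad → Type}
      [∀ v h, Monoid (Mv v h)]
      (sig : GlobalLGPFrobenioidSignature (thetaIndex (pilotDataOfK T.D T.K)).lstar (thetaIndex (pilotDataOfK T.D T.K)).V
        (· ∈ (thetaIndex (pilotDataOfK T.D T.K)).Vbad) Frd IsoF Ob realify Strip IsoS Mv)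
      (split : SplittingMonoids Mv) {ObΔ : Type}
      {N : ∀ v : (thetaIndex (pilotDataOfK T.D T.K)).V, v ∈ (thetaIndex (pilotDataOfK T.D T.K)).Vbad → Type}
      [∀ v h, Monoid (N v h)] (qData : QPilotData ObΔ N)
      (qK : ∀ v : (thetaIndex (pilotDataOfK T.D T.K)).V, v ∈ (thetaIndex (pilotDataOfK T.D T.K)).Vbad →
        Set ((logShellsDH (pilotDataOfK T.D T.K) (analyticLogv T.K)).StarPacket v)),
    ¬ Cor312Vol.PilotKummerCompatHull
        (LatticeSituation.ofShells (logShellsDH (pilotDataOfK T.D T.K) (analyticLogv T.K)) M archPk archSub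
          (summandPiecesPr (pilotDataOfK T.D T.K) (logvAnalytic_analyticLogv (F := T.K))).Adm
          (summandPiecesPr (pilotDataOfK T.D T.K) (logvAnalytic_analyticLogv (F := T.K))).logvol Ψ act Mmod region frobAdm
          frobLogvol frobΨ frobMmod unitImage ballImage thetaDiv)
        (settingPrVolSharp (pilotDataOfK T.D T.K) (logvAnalytic_analyticLogv (F := T.K)) M archPk archSub Ψ act Mmod region n
          lat sig split qData (exists_realising_qIdeles_pilotDataOfK T.D).choose (exists_realising_thetaIdeles_pilotDataOfK T.D).choose
          (exists_realising_qIdeles_pilotDataOfK T.D).choose_spec.1 (exists_realising_qIdeles_pilotDataOfK T.D).choose_spec.2.1)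
        (fun _ => Cor312.Setting.qRegion
          (settingPrVolSharp (pilotDataOfK T.D T.K) (logvAnalytic_analyticLogv (F := T.K)) M archPk archSub Ψ act Mmod region n
            lat sig split qData (exists_realising_qIdeles_pilotDataOfK T.D).choose (exists_realising_thetaIdeles_pilotDataOfK T.D).choose
            (exists_realising_qIdeles_pilotDataOfK T.D).choose_spec.1 (exists_realising_qIdeles_pilotDataOfK T.D).choose_spec.2.1))
        qK := by
  letI := T.instFieldF; letI := T.instNumberFieldF; letI := T.instAlgebraF; letI := T.instFieldK
  letI := T.instNumberFieldK; letI := T.instAlgebraK; letI := T.instFieldFbar; letI := T.instAlgebraFbar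
  letI := T.instAlgebraKFbar; letI := T.instIsElliptic
  intro M _ _ archPk archSub Ψ act Mmod region frobAdm frobLogvol frobΨ frobMmod
    unitImage ballImage thetaDiv n HT LogLink IsFull lat Frd IsoF Ob realify Strip IsoS Mv _ sig split ObΔ N _ qData qK hSH
  have hL := licence_of_pilotKummerCompatHull (hq := fun _ _ => rfl) (hc := hSH)
  exact WRow.not_licence_triple_of_hullCells_tame habc T pp hp2 hp3 hp5 hpl hpabc hv hi hcell (logvAnalytic_analyticLogv (F := T.K)) M
    archPk archSub Ψ act Mmod region n lat sig split qData (exists_realising_qIdeles_pilotDataOfK T.D).choose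
    (exists_realising_thetaIdeles_pilotDataOfK T.D).choose (exists_realising_qIdeles_pilotDataOfK T.D).choose_spec.1
    (exists_realising_qIdeles_pilotDataOfK T.D).choose_spec.2.1 (exists_realising_thetaIdeles_pilotDataOfK T.D).choose_spec.1
    (exists_realising_thetaIdeles_pilotDataOfK T.D).choose_spec.2.2 (exists_realising_qIdeles_pilotDataOfK T.D).choose_spec.2.2 hL

end Summit.ABC.IUTFork.Conditional

end
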